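import Mathlib
import Summits.Ventures.HodgeRepro2.T6N42Defs

/-!
# T6N42Hyp — sub-step N4.2 «finite places: the local theta lift of π₀,v is non-zero»: the
published inputs of the PRINT PATH, displayed

Tier 6 (README §10.2): the published theorems that sub-step N4.2 (TIER5 §N4.2 = route/T5-route-3.md
v0.36 §B rows B0–B2 + §K.2) uses AS HYPOTHESES and whose PRINT is held, each displayed as a
`Prop`-valued definition whose docstring carries the printed statement verbatim with its locator,
in the format of route/TARGET-T6.md §7(c), as a predicate of the carrier of `T6N42Defs.lean`
(ruling R5, STATUS l. 4259: displays are Props of the owner's datum, consumed as binders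
`(S) (h : Hyp.… S)`). Statement lane: `def … : Prop` and `#check` lines only.

PRINT PATH (this file): Gan–Ichino 2014 Prop. 5.3(i) — the tower property, TIER5 §K.2's
load-bearing input at the non-split places — and Mínguez 2008 Thm. 1(2) — the split places,
row B2. NOT in this file (README §9(iv) / TARGET-T6 §6 R3, author-copy class; listed as R3
candidates in route/T6-N42-t6-p5.md): GQT Prop. 35(i) (row B0, the equivalence «Θ ≠ 0 ⟺
Z_v^*(½) ≢ 0») and the unramified remark GQT p0034 ll. 94–103 (row B1, corroboration only after
§K.3). NOT displayed (corroboration only after §K.3, TIER5 §K.3): HKS96 Prop. 5.1(ii)/(iii)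
(rows B3–B4; their kernel shape is `T6N42Tower.lean`), Liu Prop. 4.13 (row B5, seat t6-p6's
display), Kudla 1986 (row B6, not held).

Layer conventions: Gan–Ichino = journal layer paper:doi-10-1007-s00222-013-0460-5 (Invent. Math.
195 (2014) 509–672; layer page `p00NN` = print page NN + 508, running heads consistent); Mínguez =
layer paper:doi-10-24033-asens-2080 (Ann. Sci. ENS 41 (2008) 717–741; layer page `p0003` = print
p. 718). Glyph losses of the layers are declared in each `[display: …]` field.

README §8(d): uses an L-value-free non-vanishing device: NO (TIER5 §N4.2, a pre-02:16Z line of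
record, continued).
-/

namespace Summit.Ventures.HodgeRepro2.T6.Hyp

open Summit.Ventures.HodgeRepro2
open Summit.Ventures.HodgeRepro2.T6.N42Defs

/-- [cite: GanIchino2013, Invent. Math. 195 (2014), no. 3, 509–672 (online-first layer, pages
unverified), §5.4 «Tower property», (5.1) + Proposition 5.3(i), online-first p. 22 ll. 11–25
(journal
layer paper:doi-10-1007-s00222-013-0460-5 p0022 ll. 11–25; = print p. 530 if the offset 508 holds —
t6-lit C14: «online-first p. N = print p. N + 508 (unverified)»)]
«For an irreducible smooth representation π of G(W ), we thus have the representation ΘVr ,W,χ,ψ (π)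
of H (Vr ). The smallest non-negative integer r0 such that ΘVr0 ,W,χ,ψ (π) = 0 is called the first
occurrence index of π for the Witt tower {Vr }, and the representation θVr0 ,W,χ,ψ (π) is called the
first occurrence of π for this Witt tower. By [61, p. 67], such an r0 exists and r0 ≤ dim W. (5.1)
The following proposition is often referred to as the tower property of theta correspondence.
Proposition 5.3 Let r0 be the first occurrence index of π for the Witt tower {Vr }. (i) We have
ΘVr ,W,χ,ψ (π) = 0 for all r ≥ r0 . (ii) If π is supercuspidal, then ΘVr0 ,W,χ,ψ (π) is irreducible
and
supercuspidal.» [display: glyph loss declared — the layer prints «= 0» at l. 13 («such that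
ΘVr0 ,W,χ,ψ (π) = 0») and at l. 24 («ΘVr ,W,χ,ψ (π) = 0 for all r ≥ r0») for the printed «≠ 0» (the
layer's bytes there are 0x08 «=», a backspace-overstruck «=»: the ≠ glyph lost; quoted here as
t6-lit's card C14 prints it, «= 0»), the reading forced by «the smallest non-negative integer r0
such that …» with (5.1) and by (ii) (TIER5 §K.4 [R-K2]; three independent layers read the same); subscripts flattened by the layer
(«ΘVr ,W,χ,ψ (π)» = Θ_{V_r,W,χ,ψ}(π)). Item (i) only; (ii) (supercuspidality of the first
occurrence) is not displayed. The Witt tower `{V_r}` with the dual pairs `(G(W), H(V_r))`, the Weil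
representations `ω_{V_r,W,χ,ψ}` and `π` are the DATUM `T : N42Defs.TowerDatum` — abstract groups
and ℂ-linear representations; the print's standing hypotheses (online-first p. 2 l. 18 «Let F be a
non-archimedean local field of characteristic 0», Case A p. 15 ll. 10–32, the splitting
`ι_{V,W,χ,ψ}` with the pair of characters `χ = (χ_V, χ_W)` p. 15 l. 63 – p. 16 l. 42, the Weil
representation `ω_{V,W,χ,ψ} := ω_ψ ∘ ι_{V,W,χ,ψ}` p. 17 ll. 14–20, `V_r = V₀ ⊕ H^r` with `V₀`
anisotropic p. 22 ll. 4–9; online-first pages throughout) are NOT expressed by the carrier and are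
the instantiation's
responsibility (TIER5 §K.2 discharges them for the datum of N4.2 at each finite place of `F⁺`
non-split in `E`). «Θ_{V_r,W,χ,ψ}(π) ≠ 0» is rendered as `T.Occurs r` = a non-zero
`G(W)`-equivariant linear map `ω_{V_r,W,χ,ψ} → π` exists (GI §5.1 online-first p. 19 ll. 24–27: the
maximal
π-isotypic quotient `π ⊠ Θ(π)` is non-zero iff such a map exists). «irreducible smooth» =
`T.Irreducible` (Mathlib `Representation.IsIrreducible`) and `T.Smooth` (open stabilisers), kept as
hypotheses. «r0 … the first occurrence index» = `T.IsFirstOccurrenceIndex r₀` (the smallest index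
that occurs, online-first p. 22 ll. 13–14); the existence claim (5.1) is NOT displayed — the display
is stated
for every `r₀` that is a first occurrence index. WEAKER than print by (ii) and (5.1); the ground
field and the construction of the dual pairs are not carried (STRONGER-looking as a predicate of an
abstract datum: the binder is instantiated only on the print's objects).] [quote-audit: QA-t6lit-25
(EXACT-AS-DECLARED; T6-LIT-SOURCES, STATUS l. 4796 (3)); card N42-C5 of route/T6-N42-t6-p5.md §11;
t6-lit card C14] -/
def GanIchino2014_Prop5_3_i (T : TowerDatum) : Prop :=
  T.Irreducible → T.Smooth →
    ∀ r₀ : ℕ, T.IsFirstOccurrenceIndex r₀ → ∀ r : ℕ, r₀ ≤ r → T.Occurs r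

#check GanIchino2014_Prop5_3_i

/-- [cite: Minguez2008, Ann. Sci. ENS 41 (2008) 717–741, Théorème 1 (2), print p. 718 (layer
paper:doi-10-24033-asens-2080 p0003 ll. 30–34 (setting) and ll. 36–37, 42–45 (the theorem))]
«Soit D une algèbre à division de centre F de dimension finie d2 sur F et soient n et m des
entiers strictement positifs. On note Mn,m (resp. Mn ) l’ensemble des matrices n × m (resp.
n × n) à coeﬃcients dans D. Le groupe GLn (D) des matrices inversibles dans Mn sera noté
Gn . Notons ωn,m la restriction de la représentation métaplectique à la paire duale Gn × Gm
(voir (1.4) pour plus de détails).» … «‹THÉORÈME› 1 (voir corollaire 6.3). – Soit π une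
représentation lisse irréductible de Gn .» … «2. Supposons n ≤ m. Alors HomGn (ωn,m , π) ‹≠› 0 et, si π
est le quotient de Langlands (cf. section 6) de l’induite parabolique τ1 × · · · × τN , où
τ1 , . . . , τN sont des représentations essentiellement de carré intégrable, alors π‹′› est le quotient
de Langlands de» [display: glyph losses declared — the layer prints the theorem head as
«Tʜ��ʀ��� 1» (small-capital ligatures lost; restored as ‹THÉORÈME› 1), «�= 0» for the printed «≠ 0»
(l. 42; restored ‹≠›), «π �» for the printed «π′» (ll. 37, 44; restored π‹′›) — restorations set in
‹…› per t6-lit's convention —, «ﬃ» as the ligature; the displayed exponent of ν after «de» (ll. 45–50) is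
exploded and not quoted. The standing field is p0002 l. 24 «Soit F un corps commutatif localement
compact non archimédien de caractéristique résiduelle p > 0.» Only the FIRST clause of item 2
(«Supposons n ≤ m. Alors HomGn (ωn,m , π) ≠ 0») is displayed: the Langlands-quotient description of
π′ and item 1 (existence, uniqueness and multiplicity one of π′) are not. The pair `(G_n, G_m)` with
`ω_{n,m}` and `π` is the DATUM `S : N42Defs.TypeIIDatum` (abstract groups, ℂ-linear
representations; `D`, `F` and the metaplectic representation are not carried — the instantiation's
responsibility: TIER5 §B row B2, at a finite place of `F⁺` split in `E`, `(U(W₁₂,v), U(V_v)) =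
(GL₂(F_v), GL₃(F_v))`, `D = F_v`, `n = 2 ≤ m = 3`). «HomGn (ωn,m , π) ≠ 0» = `S.HomNonzero` (a
non-zero
`G_n`-equivariant linear map `ω_{n,m} → π`); «lisse irréductible» = `S.Irreducible`, `S.Smooth`,
kept as hypotheses; «n et m … strictement positifs» is not imposed. WEAKER than print by the
omitted clauses.] [quote-audit: QA-t6lit-26 (EXACT-AS-DECLARED; STATUS l. 4796 (3)); card
N42-C3 of route/T6-N42-t6-p5.md §5; t6-lit card C34 (l. 4540, CONCURS)] -/
def Minguez2008_Thm1_2 (S : TypeIIDatum) : Prop :=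
  S.Irreducible → S.Smooth → S.n ≤ S.m → S.HomNonzero

#check Minguez2008_Thm1_2

/-- [cite: Minguez2008, Ann. Sci. ENS 41 (2008) 717–741, Théorème 1 (2), print p. 718 (layer
paper:doi-10-24033-asens-2080 p0003 ll. 30–34 (setting) and ll. 36–37, 42–45 (the theorem))] — the
SAME printed statement as `Minguez2008_Thm1_2` above (quotation, layer and glyph declarations
identical), now WITH the print's standing hypothesis «soient n et m des entiers strictement
positifs» (p0003 ll. 30–31) carried as `0 < S.n` (then `0 < S.m` follows from `n ≤ m`).
`Minguez2008_Thm1_2` (v1, p401080) omitted it and is therefore STRONGER than print on the corner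
`n = 0` (vacuous for the datum of N4.2, `n = 2`); it is kept unchanged by the tree's append-only
rule and is NOT consumed — `T6N42Main.lean` consumes THIS display. [display: as for
`Minguez2008_Thm1_2`, plus the positivity hypothesis; WEAKER than print by the omitted clauses
(the Langlands-quotient description of π′, item 1).] [quote-audit: QA-t6lit-26 (the same quotation as
`Minguez2008_Thm1_2`, EXACT-AS-DECLARED; STATUS l. 4796 (3)); card N42-C3 of
route/T6-N42-t6-p5.md §5; t6-lit card C34 (l. 4540, CONCURS)] -/
def Minguez2008_Theoreme1_2 (S : TypeIIDatum) : Prop :=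
  S.Irreducible → S.Smooth → 0 < S.n → S.n ≤ S.m → S.HomNonzero

#check Minguez2008_Theoreme1_2

end Summit.Ventures.HodgeRepro2.T6.Hyp
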